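import Mathlib.Combinatorics.SimpleGraph.Diam
import Literature.Computability.Cryptography.FGProblemZoo
import HarnessLib

/-!
# Orthogonal Vectors to Diameter 2 vs 3: the graph of an OV instance

The combinatorial core of the reduction behind **fine-grained.S16** (L. Roditty, V. Vassilevska
Williams, *Fast approximation algorithms for the diameter and radius of sparse graphs*, STOC 2013,
Thm. 4 of the authors' version = Thm. 1.3 as cited in `SETHHardness.lean`, proved in §4 as Thm. 9:
"Suppose one can distinguish between diameter 2 and 3 in an `m`-edge undirected unweighted graph in
time `O(m^{2-ε})` … Then … CNF-SAT on `n` variables and `m` clauses is in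
`O(2^{n(1-ε/2)} poly(m, n))` time, and SETH is false"), in its Orthogonal-Vectors form: the printed
reduction goes from CNF-SAT through the two lists of partial assignments of the two halves of the
variables, i.e. through the split-and-list OV instance (`SplitAndListOV.lean`); composing with any
OV instance `I` (`n` vectors `A p`, `B q` of dimension `d`) gives the graph `DiamRed.graph I` on
`2 + d + 2n` vertices

* two hubs `t₁ = 0`, `t₂ = 1`, a vertex `c_j = 2 + j` per coordinate, a vertex `a_p = 2 + d + p`
  per vector of the first list and `b_q = 2 + d + n + q` per vector of the second list;
* edges `t₁ t₂`, `t₁ c_j`, `t₂ c_j`, `t₁ a_p`, `t₂ b_q`, and `a_p c_j` iff `A p j = 1`,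
  `b_q c_j` iff `B q j = 1` (RV13, proof of Thm. 9: "connect every assignment node to the clauses
  that it does not satisfy" — the vector bit of the split-and-list instance is `1` exactly when the
  partial assignment does not satisfy the clause; "connect all clause nodes together with `t₁` and
  `t₂` into a clique" is replaced by the star through the two adjacent hubs, which keeps every
  distance among these nodes `≤ 2` and the graph sparse),

given as an EDGE LIST `DiamRed.edges I` of fixed length `1 + 2d + 2n(1 + d)` in which the absent
edges `a_p c_j` (`A p j = 0`) are padded by the loop entry `(a_p, a_p)` (discarded by
`Cryptography.edgeListGraph = SimpleGraph.fromRel`; the size measure of `SparseDiameter` /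
`DiameterGapApprox` counts list entries, `FGProblemZoo` module docstring), so that the word-RAM
program of `DiameterOVProgram.lean` writes every entry at a data-independent address.

Proved here: the classification of the listed pairs (`DiamRed.mem_edges`), the adjacencies, that
the graph is connected (`DiamRed.connected`), `ediam ≤ 3` always, `ediam ≤ 2` without an orthogonal
pair and `edist a_p b_q = 3` for an orthogonal pair (RV13: "the distance between `φ₁` and `φ₂` in
the graph is 3 iff they form a satisfying assignment, and all other node distances are `≤ 2`"),
hence **`DiamRed.diam_eq`**: `diam = 3` if `I` has an orthogonal pair and `diam ≤ 2` otherwise, and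
**`DiamRed.eq_three_iff`**: an `α`-approximation `D` of the diameter from below with `0 < α < 3/2`
equals `3` iff `I` has an orthogonal pair. The encoding facts (`DiamRed.inst`, lengths, entries,
input width) used by the program are at the end.

## References

* L. Roditty, V. Vassilevska Williams, *Fast approximation algorithms for the diameter and radius
  of sparse graphs*, STOC 2013, §1 Thm. 4 and §4 Thm. 9 (authors' version,
  `people.csail.mit.edu/virgi/diam.pdf`).
* V. Vassilevska Williams, *On some fine-grained questions in algorithms and complexity*,
  Proc. ICM 2018, §3–4 (OV-hardness of Diameter 2 vs 3).
-/

namespace Literature.Computability.FineGrained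

open Cryptography

namespace DiamRed

variable (I : OVInstance)

/-! ### Vertices and the edge list -/

/-- The number of vertices: two hubs, `d` coordinate vertices, `n + n` vector vertices.
[cite: RodittyVassilevskaWilliamsSTOC2013, §4 Thm. 9 (proof)] -/
def nV : ℕ := 2 + I.d + 2 * I.n

/-- The hub `t₁ = 0`. [cite: RodittyVassilevskaWilliamsSTOC2013, §4 Thm. 9 (proof)] -/
def vT1 : Fin (nV I) := ⟨0, by unfold nV; omega⟩

/-- The hub `t₂ = 1`. [cite: RodittyVassilevskaWilliamsSTOC2013, §4 Thm. 9 (proof)] -/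
def vT2 : Fin (nV I) := ⟨1, by unfold nV; omega⟩

/-- The coordinate (clause) vertex `c_j = 2 + j`.
[cite: RodittyVassilevskaWilliamsSTOC2013, §4 Thm. 9 (proof)] -/
def vC (j : Fin I.d) : Fin (nV I) := ⟨2 + j, by unfold nV; omega⟩

/-- The vertex `a_p = 2 + d + p` of vector `p` of the first list.
[cite: RodittyVassilevskaWilliamsSTOC2013, §4 Thm. 9 (proof)] -/
def vA (p : Fin I.n) : Fin (nV I) := ⟨2 + I.d + p, by unfold nV; omega⟩

/-- The vertex `b_q = 2 + d + n + q` of vector `q` of the second list.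
[cite: RodittyVassilevskaWilliamsSTOC2013, §4 Thm. 9 (proof)] -/
def vB (q : Fin I.n) : Fin (nV I) := ⟨2 + I.d + I.n + q, by unfold nV; omega⟩

/-- The hub–coordinate edges `t₁ c_j`, `t₂ c_j`. [cite: RodittyVassilevskaWilliamsSTOC2013, §4 Thm. 9 (proof)] -/
def edgesC : List (Fin (nV I) × Fin (nV I)) :=
  (List.finRange I.d).flatMap fun j => [(vT1 I, vC I j), (vT2 I, vC I j)]

/-- The block of vector `p` of the first list: `t₁ a_p`, then for each coordinate `j` the edge
`a_p c_j` if `A p j = 1` and the padding loop `(a_p, a_p)` otherwise.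
[cite: RodittyVassilevskaWilliamsSTOC2013, §4 Thm. 9 (proof)] -/
def blockA (p : Fin I.n) : List (Fin (nV I) × Fin (nV I)) :=
  (vT1 I, vA I p) :: (List.finRange I.d).map fun j =>
    if I.A p j then (vA I p, vC I j) else (vA I p, vA I p)

/-- The block of vector `q` of the second list: `t₂ b_q`, then `b_q c_j` or the padding loop.
[cite: RodittyVassilevskaWilliamsSTOC2013, §4 Thm. 9 (proof)] -/
def blockB (q : Fin I.n) : List (Fin (nV I) × Fin (nV I)) :=
  (vT2 I, vB I q) :: (List.finRange I.d).map fun j =>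
    if I.B q j then (vB I q, vC I j) else (vB I q, vB I q)

/-- **The edge list** of the Diameter instance of `I`: `t₁ t₂`, the hub–coordinate edges, the
blocks of the first list, the blocks of the second list.
[cite: RodittyVassilevskaWilliamsSTOC2013, §4 Thm. 9 (proof)] -/
def edges : List (Fin (nV I) × Fin (nV I)) :=
  (vT1 I, vT2 I) :: (edgesC I ++ ((List.finRange I.n).flatMap (blockA I) ++
    (List.finRange I.n).flatMap (blockB I)))

/-- The graph of the instance (symmetrised, loops discarded). [cite: RodittyVassilevskaWilliamsSTOC2013, §4 Thm. 9 (proof)] -/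
def graph : SimpleGraph (Fin (nV I)) := edgeListGraph (edges I)

/-- The number of listed entries: `1 + 2d + 2n(1 + d)`. [folklore] -/
def ne : ℕ := 1 + 2 * I.d + 2 * (I.n * (1 + I.d))

/-- The edge list has `ne I` entries. [folklore] -/
theorem length_edges : (edges I).length = ne I := by
  simp [edges, edgesC, blockA, blockB, ne, List.length_flatMap]
  ring

/-! ### Classification of the listed pairs -/

/-- Every listed pair is one of: `t₁ t₂`; a hub with a coordinate vertex; `t₁ a_p`; `t₂ b_q`;
`a_p c_j` with `A p j = 1`; `b_q c_j` with `B q j = 1`; a loop. (Stated on vertex numbers.)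
[folklore] -/
theorem mem_edges {e : Fin (nV I) × Fin (nV I)} (h : e ∈ edges I) :
    ((e.1 : ℕ) = 0 ∧ (e.2 : ℕ) = 1) ∨
    ((e.1 : ℕ) ≤ 1 ∧ 2 ≤ (e.2 : ℕ) ∧ (e.2 : ℕ) < 2 + I.d) ∨
    ((e.1 : ℕ) = 0 ∧ 2 + I.d ≤ (e.2 : ℕ) ∧ (e.2 : ℕ) < 2 + I.d + I.n) ∨
    ((e.1 : ℕ) = 1 ∧ 2 + I.d + I.n ≤ (e.2 : ℕ)) ∨
    (∃ (p : Fin I.n) (j : Fin I.d), I.A p j = true ∧ e = (vA I p, vC I j)) ∨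
    (∃ (q : Fin I.n) (j : Fin I.d), I.B q j = true ∧ e = (vB I q, vC I j)) ∨
    e.1 = e.2 := by
  simp only [edges, edgesC, blockA, blockB, List.mem_cons, List.mem_append, List.mem_flatMap,
    List.mem_finRange, true_and, List.mem_map, List.not_mem_nil, or_false] at h
  rcases h with rfl | ⟨j, rfl | rfl⟩ | ⟨p, rfl | ⟨j, hj⟩⟩ | ⟨q, rfl | ⟨j, hj⟩⟩
  · exact Or.inl ⟨rfl, rfl⟩
  · exact Or.inr (Or.inl ⟨by simp [vT1], by simp [vC], by simp [vC]⟩)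
  · exact Or.inr (Or.inl ⟨by simp [vT2], by simp [vC], by simp [vC]⟩)
  · exact Or.inr (Or.inr (Or.inl ⟨rfl, by simp [vA], by simp [vA]⟩))
  · by_cases hA : I.A p j = true
    · rw [if_pos hA] at hj
      exact Or.inr (Or.inr (Or.inr (Or.inr (Or.inl ⟨p, j, hA, hj.symm⟩))))
    · rw [if_neg hA] at hj
      exact Or.inr (Or.inr (Or.inr (Or.inr (Or.inr (Or.inr (by rw [← hj]))))))
  · exact Or.inr (Or.inr (Or.inr (Or.inl ⟨rfl, by simp [vB]⟩)))
  · by_cases hB : I.B q j = true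
    · rw [if_pos hB] at hj
      exact Or.inr (Or.inr (Or.inr (Or.inr (Or.inr (Or.inl ⟨q, j, hB, hj.symm⟩)))))
    · rw [if_neg hB] at hj
      exact Or.inr (Or.inr (Or.inr (Or.inr (Or.inr (Or.inr (by rw [← hj]))))))

/-- Adjacency in the graph is membership of the pair or of its reverse, between distinct
vertices. [folklore] -/
theorem adj_iff {x y : Fin (nV I)} :
    (graph I).Adj x y ↔ x ≠ y ∧ ((x, y) ∈ edges I ∨ (y, x) ∈ edges I) := by
  simp [graph, edgeListGraph, SimpleGraph.fromRel_adj]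

/-- A listed pair of distinct vertices is an edge. [folklore] -/
theorem adj_of_mem {x y : Fin (nV I)} (h : (x, y) ∈ edges I) (hne : (x : ℕ) ≠ y) :
    (graph I).Adj x y :=
  (adj_iff I).2 ⟨fun heq => hne (by rw [heq]), Or.inl h⟩

/-! ### The adjacencies present -/

/-- `t₁ t₂` is an edge. [folklore] -/
theorem adj_T1_T2 : (graph I).Adj (vT1 I) (vT2 I) :=
  adj_of_mem I (by simp [edges]) (by simp [vT1, vT2])

/-- `t₁ c_j` is an edge. [folklore] -/
theorem adj_T1_C (j : Fin I.d) : (graph I).Adj (vT1 I) (vC I j) :=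
  adj_of_mem I (by
    refine List.mem_cons_of_mem _ (List.mem_append_left _ ?_)
    exact List.mem_flatMap.2 ⟨j, List.mem_finRange j, by simp⟩) (by simp [vT1, vC]; omega)

/-- `t₂ c_j` is an edge. [folklore] -/
theorem adj_T2_C (j : Fin I.d) : (graph I).Adj (vT2 I) (vC I j) :=
  adj_of_mem I (by
    refine List.mem_cons_of_mem _ (List.mem_append_left _ ?_)
    exact List.mem_flatMap.2 ⟨j, List.mem_finRange j, by simp⟩) (by simp [vT2, vC]; omega)

/-- `t₁ a_p` is an edge. [folklore] -/
theorem adj_T1_A (p : Fin I.n) : (graph I).Adj (vT1 I) (vA I p) :=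
  adj_of_mem I (by
    refine List.mem_cons_of_mem _ (List.mem_append_right _ (List.mem_append_left _ ?_))
    exact List.mem_flatMap.2 ⟨p, List.mem_finRange p, by simp [blockA]⟩) (by simp [vT1, vA]; omega)

/-- `t₂ b_q` is an edge. [folklore] -/
theorem adj_T2_B (q : Fin I.n) : (graph I).Adj (vT2 I) (vB I q) :=
  adj_of_mem I (by
    refine List.mem_cons_of_mem _ (List.mem_append_right _ (List.mem_append_right _ ?_))
    exact List.mem_flatMap.2 ⟨q, List.mem_finRange q, by simp [blockB]⟩) (by simp [vT2, vB]; omega)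

/-- `a_p c_j` is an edge when `A p j = 1`. [folklore] -/
theorem adj_A_C {p : Fin I.n} {j : Fin I.d} (h : I.A p j = true) :
    (graph I).Adj (vA I p) (vC I j) :=
  adj_of_mem I (by
    refine List.mem_cons_of_mem _ (List.mem_append_right _ (List.mem_append_left _ ?_))
    refine List.mem_flatMap.2 ⟨p, List.mem_finRange p, List.mem_cons_of_mem _ ?_⟩
    exact List.mem_map.2 ⟨j, List.mem_finRange j, by rw [if_pos h]⟩) (by simp [vA, vC]; omega)

/-- `b_q c_j` is an edge when `B q j = 1`. [folklore] -/
theorem adj_B_C {q : Fin I.n} {j : Fin I.d} (h : I.B q j = true) :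
    (graph I).Adj (vB I q) (vC I j) :=
  adj_of_mem I (by
    refine List.mem_cons_of_mem _ (List.mem_append_right _ (List.mem_append_right _ ?_))
    refine List.mem_flatMap.2 ⟨q, List.mem_finRange q, List.mem_cons_of_mem _ ?_⟩
    exact List.mem_map.2 ⟨j, List.mem_finRange j, by rw [if_pos h]⟩) (by simp [vB, vC]; omega)

/-! ### The adjacencies absent -/

/-- The neighbours of `a_p` are `t₁` and the `c_j` with `A p j = 1`. [folklore] -/
theorem adj_A_left {p : Fin I.n} {y : Fin (nV I)} (h : (graph I).Adj (vA I p) y) :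
    (y : ℕ) = 0 ∨ ∃ j : Fin I.d, y = vC I j ∧ I.A p j = true := by
  obtain ⟨hne, hm | hm⟩ := (adj_iff I).1 h
  · rcases mem_edges I hm with h0 | h0 | h0 | h0 | ⟨p', j, hA, he⟩ | ⟨q, j, -, he⟩ | h0
    · simp [vA] at h0
    · simp [vA] at h0; omega
    · simp [vA] at h0
    · simp [vA] at h0; omega
    · simp only [Prod.mk.injEq] at he
      have hp : p = p' := by
        have := congrArg Fin.val he.1; simp [vA] at this; exact Fin.ext this
      subst hp
      exact Or.inr ⟨j, he.2, hA⟩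
    · have := congrArg Fin.val (Prod.mk.inj he).1; simp [vA, vB] at this; omega
    · exact absurd h0.symm (by simpa using hne.symm)
  · rcases mem_edges I hm with h0 | h0 | h0 | h0 | ⟨p', j, -, he⟩ | ⟨q, j, -, he⟩ | h0
    · simp [vA] at h0; omega
    · simp [vA] at h0
    · exact Or.inl h0.1
    · simp [vA] at h0; omega
    · have := congrArg Fin.val (Prod.mk.inj he).2; simp [vA, vC] at this; omega
    · have := congrArg Fin.val (Prod.mk.inj he).2; simp [vA, vC] at this; omega
    · exact absurd h0 (by simpa using hne.symm)

/-- The neighbours of `b_q` are `t₂` and the `c_j` with `B q j = 1`. [folklore] -/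
theorem adj_B_left {q : Fin I.n} {y : Fin (nV I)} (h : (graph I).Adj (vB I q) y) :
    (y : ℕ) = 1 ∨ ∃ j : Fin I.d, y = vC I j ∧ I.B q j = true := by
  obtain ⟨hne, hm | hm⟩ := (adj_iff I).1 h
  · rcases mem_edges I hm with h0 | h0 | h0 | h0 | ⟨p, j, -, he⟩ | ⟨q', j, hB, he⟩ | h0
    · simp [vB] at h0
    · simp [vB] at h0; omega
    · simp [vB] at h0
    · simp [vB] at h0; omega
    · have := congrArg Fin.val (Prod.mk.inj he).1; simp [vA, vB] at this; omega
    · simp only [Prod.mk.injEq] at he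
      have hq : q = q' := by
        have := congrArg Fin.val he.1; simp [vB] at this; exact Fin.ext this
      subst hq
      exact Or.inr ⟨j, he.2, hB⟩
    · exact absurd h0.symm (by simpa using hne.symm)
  · rcases mem_edges I hm with h0 | h0 | h0 | h0 | ⟨p, j, -, he⟩ | ⟨q', j, -, he⟩ | h0
    · simp [vB] at h0; omega
    · simp [vB] at h0; omega
    · simp [vB] at h0
    · exact Or.inl h0.1
    · have := congrArg Fin.val (Prod.mk.inj he).2; simp [vB, vC] at this; omega
    · have := congrArg Fin.val (Prod.mk.inj he).2; simp [vB, vC] at this; omega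
    · exact absurd h0 (by simpa using hne.symm)

/-- `a_p` and `b_q` are distinct, non-adjacent, and their common neighbours are the `c_j` with
`A p j = B q j = 1`; for an orthogonal pair there is none. [folklore] -/
theorem two_lt_edist_A_B {p q : Fin I.n} (h : AreOrthogonal (I.A p) (I.B q)) :
    2 < (graph I).edist (vA I p) (vB I q) := by
  refine SimpleGraph.two_lt_edist_iff.2 ⟨?_, fun hadj => ?_, ?_⟩
  · intro he; have := congrArg Fin.val he; simp [vA, vB] at this; omega
  · rcases adj_A_left I hadj with h0 | ⟨j, hj, -⟩
    · simp [vB] at h0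
    · have := congrArg Fin.val hj; simp [vB, vC] at this; omega
  · ext w
    simp only [SimpleGraph.mem_commonNeighbors, Set.mem_empty_iff_false, iff_false, not_and]
    intro hA hB
    rcases adj_A_left I hA with h0 | ⟨j, rfl, hAj⟩
    · rcases adj_B_left I hB with h1 | ⟨j, rfl, -⟩
      · omega
      · simp [vC] at h0
    · rcases adj_B_left I hB with h1 | ⟨j', hjj', hBj⟩
      · simp [vC] at h1; omega
      · have : j = j' := by
          have := congrArg Fin.val hjj'; simp [vC] at this; exact Fin.ext this
        subst this
        exact h j ⟨hAj, hBj⟩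

/-! ### Distances -/

/-- Every vertex other than the `b_q` is `t₁` or a neighbour of `t₁`. [folklore] -/
theorem edist_T1_le_one {x : Fin (nV I)} (hx : (x : ℕ) < 2 + I.d + I.n) :
    (graph I).edist (vT1 I) x ≤ 1 := by
  rw [SimpleGraph.edist_le_one_iff_adj_or_eq]
  rcases Nat.lt_or_ge (x : ℕ) 2 with h2 | h2
  · rcases Nat.lt_or_ge (x : ℕ) 1 with h1 | h1
    · right; apply Fin.ext; simp [vT1]; omega
    · left
      have : x = vT2 I := Fin.ext (by simp [vT2]; omega)
      rw [this]; exact adj_T1_T2 I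
  · left
    rcases Nat.lt_or_ge (x : ℕ) (2 + I.d) with hd | hd
    · have : x = vC I ⟨x - 2, by omega⟩ := Fin.ext (by simp [vC]; omega)
      rw [this]; exact adj_T1_C I _
    · have : x = vA I ⟨x - 2 - I.d, by omega⟩ := Fin.ext (by simp [vA]; omega)
      rw [this]; exact adj_T1_A I _

/-- Every vertex other than `t₁` and the `a_p` is `t₂` or a neighbour of `t₂`. [folklore] -/
theorem edist_T2_le_one {x : Fin (nV I)}
    (hx : (x : ℕ) = 1 ∨ (2 ≤ (x : ℕ) ∧ (x : ℕ) < 2 + I.d) ∨ 2 + I.d + I.n ≤ (x : ℕ)) :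
    (graph I).edist (vT2 I) x ≤ 1 := by
  rw [SimpleGraph.edist_le_one_iff_adj_or_eq]
  rcases hx with h1 | ⟨h2, hd⟩ | hb
  · right; exact Fin.ext (by simp [vT2]; omega)
  · left
    have : x = vC I ⟨x - 2, by omega⟩ := Fin.ext (by simp [vC]; omega)
    rw [this]; exact adj_T2_C I _
  · left
    have hlt := x.2
    simp only [nV] at hlt
    have : x = vB I ⟨x - 2 - I.d - I.n, by omega⟩ := Fin.ext (by simp [vB]; omega)
    rw [this]; exact adj_T2_B I _

/-- `t₁` is adjacent to `t₂`. [folklore] -/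
theorem edist_T1_T2 : (graph I).edist (vT1 I) (vT2 I) = 1 :=
  SimpleGraph.edist_eq_one_iff_adj.2 (adj_T1_T2 I)

/-- Every vertex is within distance `2` of `t₁`. [folklore] -/
theorem edist_T1_le_two (x : Fin (nV I)) : (graph I).edist (vT1 I) x ≤ 2 := by
  rcases Nat.lt_or_ge (x : ℕ) (2 + I.d + I.n) with hx | hx
  · exact (edist_T1_le_one I hx).trans (by norm_num)
  · calc (graph I).edist (vT1 I) x ≤ (graph I).edist (vT1 I) (vT2 I) + (graph I).edist (vT2 I) x :=
          (graph I).edist_triangle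
      _ ≤ 1 + 1 := add_le_add (edist_T1_T2 I).le (edist_T2_le_one I (Or.inr (Or.inr hx)))
      _ = 2 := by norm_num

/-- Every vertex is within distance `2` of `t₂`. [folklore] -/
theorem edist_T2_le_two (x : Fin (nV I)) : (graph I).edist (vT2 I) x ≤ 2 := by
  rcases Nat.lt_or_ge (x : ℕ) (2 + I.d + I.n) with hx | hx
  · calc (graph I).edist (vT2 I) x ≤ (graph I).edist (vT2 I) (vT1 I) + (graph I).edist (vT1 I) x :=
          (graph I).edist_triangle
      _ ≤ 1 + 1 := add_le_add (by rw [SimpleGraph.edist_comm]; exact (edist_T1_T2 I).le)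
          (edist_T1_le_one I hx)
      _ = 2 := by norm_num
  · exact (edist_T2_le_one I (Or.inr (Or.inr hx))).trans (by norm_num)

/-- **All distances are at most `3`.** [cite: RodittyVassilevskaWilliamsSTOC2013, §4 Thm. 9 (proof)] -/
theorem edist_le_three (u v : Fin (nV I)) : (graph I).edist u v ≤ 3 := by
  rcases Nat.lt_or_ge (u : ℕ) (2 + I.d + I.n) with hu | hu
  · calc (graph I).edist u v ≤ (graph I).edist u (vT1 I) + (graph I).edist (vT1 I) v :=
          (graph I).edist_triangle
      _ ≤ 1 + 2 := add_le_add (by rw [SimpleGraph.edist_comm]; exact edist_T1_le_one I hu)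
          (edist_T1_le_two I v)
      _ = 3 := by norm_num
  · calc (graph I).edist u v ≤ (graph I).edist u (vT2 I) + (graph I).edist (vT2 I) v :=
          (graph I).edist_triangle
      _ ≤ 1 + 2 := add_le_add (by rw [SimpleGraph.edist_comm]; exact edist_T2_le_one I (Or.inr (Or.inr hu)))
          (edist_T2_le_two I v)
      _ = 3 := by norm_num

/-- Without an orthogonal pair, `a_p` and `b_q` have a common neighbour `c_j`
(`A p j = B q j = 1`). [cite: RodittyVassilevskaWilliamsSTOC2013, §4 Thm. 9 (proof)] -/
theorem edist_A_B_le_two {p q : Fin I.n} (h : ¬ AreOrthogonal (I.A p) (I.B q)) :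
    (graph I).edist (vA I p) (vB I q) ≤ 2 := by
  unfold AreOrthogonal at h
  push Not at h
  obtain ⟨j, hA, hB⟩ := h
  have := (SimpleGraph.Walk.cons (adj_A_C I hA)
    (SimpleGraph.Walk.cons (adj_B_C I hB).symm .nil)).edist_le
  simpa using this

/-- **Without an orthogonal pair all distances are at most `2`.**
[cite: RodittyVassilevskaWilliamsSTOC2013, §4 Thm. 9 (proof)] -/
theorem edist_le_two (h : ¬ I.HasOrthogonalPair) (u v : Fin (nV I)) : (graph I).edist u v ≤ 2 := by
  have hno : ∀ p q, ¬ AreOrthogonal (I.A p) (I.B q) := fun p q ho => h ⟨p, q, ho⟩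
  -- `u` (and symmetrically `v`) is within `1` of `t₁` or of `t₂`
  have h12 : ∀ x : Fin (nV I), (x : ℕ) < 2 + I.d + I.n ∨ 2 + I.d + I.n ≤ (x : ℕ) := fun x =>
    Nat.lt_or_ge _ _
  have viaT1 : ∀ x y : Fin (nV I), (x : ℕ) < 2 + I.d + I.n → (y : ℕ) < 2 + I.d + I.n →
      (graph I).edist x y ≤ 2 := fun x y hx hy =>
    calc (graph I).edist x y ≤ (graph I).edist x (vT1 I) + (graph I).edist (vT1 I) y :=
          (graph I).edist_triangle
      _ ≤ 1 + 1 := add_le_add (by rw [SimpleGraph.edist_comm]; exact edist_T1_le_one I hx)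
          (edist_T1_le_one I hy)
      _ = 2 := by norm_num
  have viaT2 : ∀ x y : Fin (nV I),
      ((x : ℕ) = 1 ∨ (2 ≤ (x : ℕ) ∧ (x : ℕ) < 2 + I.d) ∨ 2 + I.d + I.n ≤ (x : ℕ)) →
      ((y : ℕ) = 1 ∨ (2 ≤ (y : ℕ) ∧ (y : ℕ) < 2 + I.d) ∨ 2 + I.d + I.n ≤ (y : ℕ)) →
      (graph I).edist x y ≤ 2 := fun x y hx hy =>
    calc (graph I).edist x y ≤ (graph I).edist x (vT2 I) + (graph I).edist (vT2 I) y :=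
          (graph I).edist_triangle
      _ ≤ 1 + 1 := add_le_add (by rw [SimpleGraph.edist_comm]; exact edist_T2_le_one I hx)
          (edist_T2_le_one I hy)
      _ = 2 := by norm_num
  -- the mixed pairs `{a_p or t₁, b_q}`
  have mixed : ∀ x y : Fin (nV I), (x : ℕ) < 2 + I.d + I.n → 2 + I.d + I.n ≤ (y : ℕ) →
      (graph I).edist x y ≤ 2 := by
    intro x y hx hy
    have hylt := y.2
    simp only [nV] at hylt
    rcases Nat.lt_or_ge (x : ℕ) 2 with h2 | h2
    · rcases Nat.lt_or_ge (x : ℕ) 1 with h1 | h1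
      · have : x = vT1 I := Fin.ext (by simp [vT1]; omega)
        rw [this]; exact edist_T1_le_two I y
      · exact viaT2 x y (Or.inl (by omega)) (Or.inr (Or.inr hy))
    · rcases Nat.lt_or_ge (x : ℕ) (2 + I.d) with hd | hd
      · exact viaT2 x y (Or.inr (Or.inl ⟨h2, hd⟩)) (Or.inr (Or.inr hy))
      · have hxA : x = vA I ⟨x - 2 - I.d, by omega⟩ := Fin.ext (by simp [vA]; omega)
        have hyB : y = vB I ⟨y - 2 - I.d - I.n, by omega⟩ := Fin.ext (by simp [vB]; omega)
        rw [hxA, hyB]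
        exact edist_A_B_le_two I (hno _ _)
  rcases h12 u with hu | hu <;> rcases h12 v with hv | hv
  · exact viaT1 u v hu hv
  · exact mixed u v hu hv
  · rw [SimpleGraph.edist_comm]; exact mixed v u hv hu
  · exact viaT2 u v (Or.inr (Or.inr hu)) (Or.inr (Or.inr hv))

/-! ### Diameter and connectivity -/

/-- The vertex type is nonempty (there are two hubs). [folklore] -/
instance : Nonempty (Fin (nV I)) := ⟨vT1 I⟩

/-- The extended diameter is at most `3`. [cite: RodittyVassilevskaWilliamsSTOC2013, §4 Thm. 9 (proof)] -/
theorem ediam_le_three : (graph I).ediam ≤ 3 :=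
  SimpleGraph.ediam_le_of_edist_le (edist_le_three I)

/-- **The graph is connected** (as required of `SparseDiameter` / `DiameterGapApprox` instances).
[cite: RodittyVassilevskaWilliamsSTOC2013, §4 Thm. 9 (proof)] -/
theorem connected : (graph I).Connected :=
  SimpleGraph.connected_of_ediam_ne_top (ne_top_of_le_ne_top (by decide) (ediam_le_three I))

/-- **With an orthogonal pair the extended diameter is `3`.**
[cite: RodittyVassilevskaWilliamsSTOC2013, §4 Thm. 9 (proof)] -/
theorem ediam_eq_three (h : I.HasOrthogonalPair) : (graph I).ediam = 3 := by
  refine le_antisymm (ediam_le_three I) ?_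
  obtain ⟨p, q, hpq⟩ := h
  have h3 : (3 : ℕ∞) ≤ (graph I).edist (vA I p) (vB I q) := by
    have := two_lt_edist_A_B I hpq
    have h32 : (3 : ℕ∞) = 2 + 1 := by norm_num
    rw [h32]
    exact Order.add_one_le_of_lt this
  exact h3.trans SimpleGraph.edist_le_ediam

/-- **Without an orthogonal pair the extended diameter is at most `2`.**
[cite: RodittyVassilevskaWilliamsSTOC2013, §4 Thm. 9 (proof)] -/
theorem ediam_le_two (h : ¬ I.HasOrthogonalPair) : (graph I).ediam ≤ 2 :=
  SimpleGraph.ediam_le_of_edist_le (edist_le_two I h)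

/-- **The diameter of the instance** (Mathlib's `SimpleGraph.diam`): `3` if `I` has an orthogonal
pair. [cite: RodittyVassilevskaWilliamsSTOC2013, §4 Thm. 9] -/
theorem diam_eq_three (h : I.HasOrthogonalPair) : (graph I).diam = 3 := by
  rw [SimpleGraph.diam, ediam_eq_three I h]; rfl

/-- The diameter is at most `2` if `I` has no orthogonal pair. [cite: RodittyVassilevskaWilliamsSTOC2013, §4 Thm. 9] -/
theorem diam_le_two (h : ¬ I.HasOrthogonalPair) : (graph I).diam ≤ 2 :=
  ENat.toNat_le_of_le_coe (ediam_le_two I h)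

/-- The diameter is at most `3`. [cite: RodittyVassilevskaWilliamsSTOC2013, §4 Thm. 9] -/
theorem diam_le_three : (graph I).diam ≤ 3 :=
  ENat.toNat_le_of_le_coe (ediam_le_three I)

/-- **Reading the answer off an approximation.** If `D` approximates the diameter from below within
a factor `α` with `0 < α < 3/2` (`diam / α ≤ D ≤ diam`, the accepted outputs of
`DiameterGapApprox α`), then `D = 3` iff `I` has an orthogonal pair: with a pair `diam = 3` and
`D ≥ 3/α > 2`; without, `D ≤ diam ≤ 2`. (RV13, Remark after Thm. 9: "any `(3/2 - ε)`-approximation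
algorithm can distinguish between diameter 2 and 3".) [cite: RodittyVassilevskaWilliamsSTOC2013, §4 Thm. 9 (Remark)] -/
theorem eq_three_iff {α : ℚ} (hα : 0 < α) (hα' : α < 3 / 2) {D : ℕ}
    (hlo : ((graph I).diam : ℚ) / α ≤ D) (hhi : D ≤ (graph I).diam) :
    D = 3 ↔ I.HasOrthogonalPair := by
  constructor
  · intro hD
    by_contra h
    have := diam_le_two I h
    omega
  · intro h
    have h3 := diam_eq_three I h
    rw [h3] at hlo hhi
    have hD2 : (2 : ℚ) < D := by
      have : (2 : ℚ) < (3 : ℕ) / α := by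
        rw [lt_div_iff₀ hα]; push_cast; linarith
      exact this.trans_le hlo
    have : 2 < D := by exact_mod_cast hD2
    omega

end DiamRed

end Literature.Computability.FineGrained
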